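import Summits.Ventures.PercRepro.Concavity5
import Summits.Ventures.PercRepro.BlockFlipHarris

/-!
# C-014 in the typed vocabulary: `P(B_q) · P(q′ ↮ q″) ≤ P(A_q) · P(q′ ↔ q″)` on the merge types

typer-2's merge types of an edge `g` (`Concavity6.lean`, `Concavity5.lean`) are events of `G − g`
(`ConnWithout g`).  For an edge `g` with `G.fst g = a` and the crossing cell `i` pairing `a` with
`q` (the other block `{q′, q″}`), the type `B_q = typeB g a b c d i` is the pull-back along
`ω ↦ ω[g := false]` of `F ∩ N ∩ J` of `BlockFlipHarris.lean`, and `A_q = typeA g a b c d i` of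
`F ∩ N ∩ Jᶜ` (`typeB_eq_preimage`, `typeA_eq_preimage`).  Since these events do not see `g`,
`P_p(·) = P_{p[g := 0]}(·)` (`prob_preimage_update_false`), and `vMark_block_flip` at `p[g := 0]`
gives the **typed C-014**:

  `C014_typed : P_p(B_q) · P_p(q′ ↮ q″ in G − g) ≤ P_p(A_q) · P_p(q′ ↔ q″ in G − g)`

for every multigraph, every `p`, every `i : Fin 3` — the statement of `Lemma6Gen` with the
right-hand factor `P(E^v)` weakened to `P(J)` and the left-hand bracket strengthened to `P(Jᶜ)`.
(`Lemma6Gen` itself is FALSE — mine-4's witness, INBOX 2026-08-22T05:30:24Z.)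
-/

namespace PercRepro

open Finset

/-! ### Transport: events that do not see `g` -/

section Transport

variable {E : Type*} [Fintype E] [DecidableEq E]

/-- The pull-back of an event along `ω ↦ ω[g := false]` has the same probability under `p` as
the event itself under `p[g := 0]`. -/
theorem prob_preimage_update_false (p : E → ℝ) (g : E) (A : Set (Config E)) :
    prob p ((fun ω => Function.update ω g false) ⁻¹' A) = prob (Function.update p g 0) A := by
  have h1 : prob (Function.update p g 1) ((fun ω => Function.update ω g false) ⁻¹' A) =
      prob (Function.update p g 0) ((fun ω => Function.update ω g false) ⁻¹' A) := by
    rw [prob_update_one_eq_prob_update_zero_preimage]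
    refine prob_congr_of_support _ fun ω hw => ?_
    have h0 : ω g = false :=
      eq_false_of_weight_ne_zero_of_eq_zero hw (Function.update_self g 0 p)
    simp only [Set.mem_preimage, flipEdge, h0, Bool.not_false, Function.update_idem]
  have h2 : prob (Function.update p g 0) ((fun ω => Function.update ω g false) ⁻¹' A) =
      prob (Function.update p g 0) A := by
    refine prob_congr_of_support _ fun ω hw => ?_
    have h0 : ω g = false :=
      eq_false_of_weight_ne_zero_of_eq_zero hw (Function.update_self g 0 p)
    rw [Set.mem_preimage, show Function.update ω g false = ω from by
      funext e; by_cases he : e = g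
      · subst he; simp [h0]
      · simp [Function.update_of_ne he]]
  rw [prob_split p g, h1, h2]
  ring

end Transport

namespace MultiGraph

variable {V E : Type*} (G : MultiGraph V E) [DecidableEq E]

/-! ### The merge types `B_q`, `A_q` as pull-backs of `F ∩ N ∩ J`, `F ∩ N ∩ Jᶜ` -/

/-- `B_q` as a pull-back: for `G.fst g = a`, `G.snd g = v` and the crossing cell `i` with blocks
`{a, q}`, `{q′, q″}`, `typeB g a b c d i = (· [g := false]) ⁻¹' (F ∩ N ∩ J)`. -/
theorem typeB_eq_preimage (g : E) (a b c d q q' q'' : V) (i : Fin 3) (hg : G.fst g = a)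
    (hi : crossBlocks a b c d i = ((a, q), (q', q''))) :
    G.typeB g a b c d i = (fun ω => Function.update ω g false) ⁻¹'
      (G.vMark (G.snd g) a q q' q'' ∩ G.markFree a (G.snd g) q q' q'' ∩ G.connEvent q' q'') := by
  ext ω
  simp only [typeB, hi, Set.mem_setOf_eq, Set.mem_preimage, Set.mem_inter_iff, vMark, markFree,
    pairEvent, sepEvent, connEvent, isRank1Cell, linksPair, ConnWithout, Set.mem_compl_iff, hg]
  set ω' := Function.update ω g false
  set v := G.snd g
  have tr : ∀ {x y z : V}, G.Conn ω' x y → G.Conn ω' y z → G.Conn ω' x z := fun h1 h2 => h1.trans h2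
  have sy : ∀ {x y : V}, G.Conn ω' x y → G.Conn ω' y x := fun h => h.symm
  constructor
  · rintro (⟨⟨hq'q'', hq'a, hq'q, hq''a, hq''q, haq⟩, hl⟩ | ⟨⟨haq, haq', haq'', _, _, _⟩, hl⟩)
    · have hvq : G.Conn ω' v q := by
        rcases hl with ⟨_, h⟩ | ⟨h, _⟩
        · exact h
        · exact absurd h haq
      have h1 : ¬ G.Conn ω' v q' := fun h => hq'q (tr (sy h) hvq)
      have h2 : ¬ G.Conn ω' v q'' := fun h => hq''q (tr (sy h) hvq)
      have h3 : ¬ G.Conn ω' v a := fun h => haq (tr (sy h) hvq)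
      have h4 : ¬ G.Conn ω' a v := fun h => haq (tr h hvq)
      have h5 : ¬ G.Conn ω' a q' := fun h => hq'a (sy h)
      have h6 : ¬ G.Conn ω' a q'' := fun h => hq''a (sy h)
      exact ⟨⟨⟨⟨⟨hvq, h1⟩, h2⟩, h3⟩, ⟨⟨⟨h4, haq⟩, h5⟩, h6⟩⟩, hq'q''⟩
    · rcases hl with ⟨h, _⟩ | ⟨h, _⟩
      · exact absurd h haq'
      · exact absurd h haq''
  · rintro ⟨⟨⟨⟨⟨hvq, hvq'⟩, hvq''⟩, _⟩, ⟨⟨⟨_, haq⟩, haq'⟩, haq''⟩⟩, hq'q''⟩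
    left
    exact ⟨⟨hq'q'', fun h => haq' (sy h), fun h => hvq' (tr hvq (sy h)), fun h => haq'' (sy h),
      fun h => hvq'' (tr hvq (sy h)), haq⟩, Or.inl ⟨Conn.refl G ω' a, hvq⟩⟩

/-- `sepAllFour` in the canonical orientation of the crossing cell `i` (`{a, q}`, `{q′, q″}`). -/
theorem sepAllFour_iff_canon (g : E) (a b c d q q' q'' : V) (i : Fin 3)
    (hi : crossBlocks a b c d i = ((a, q), (q', q''))) (ω : Config E) :
    G.sepAllFour g a b c d ω ↔
      (¬ G.ConnWithout g ω a q ∧ ¬ G.ConnWithout g ω a q' ∧ ¬ G.ConnWithout g ω a q'' ∧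
        ¬ G.ConnWithout g ω q q' ∧ ¬ G.ConnWithout g ω q q'' ∧ ¬ G.ConnWithout g ω q' q'') := by
  have sy : ∀ {x y : V}, G.ConnWithout g ω x y → G.ConnWithout g ω y x := fun h => h.symm
  fin_cases i <;> simp only [crossBlocks] at hi <;>
    obtain ⟨⟨rfl, rfl⟩, rfl, rfl⟩ := hi <;> simp only [sepAllFour] <;> constructor <;>
    rintro ⟨h1, h2, h3, h4, h5, h6⟩ <;> refine ⟨?_, ?_, ?_, ?_, ?_, ?_⟩ <;>
    first
    | assumption
    | exact fun h => h1 (sy h)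
    | exact fun h => h2 (sy h)
    | exact fun h => h3 (sy h)
    | exact fun h => h4 (sy h)
    | exact fun h => h5 (sy h)
    | exact fun h => h6 (sy h)

/-- `A_q` as a pull-back: `typeA g a b c d i = (· [g := false]) ⁻¹' (F ∩ N ∩ Jᶜ)`. -/
theorem typeA_eq_preimage (g : E) (a b c d q q' q'' : V) (i : Fin 3) (hg : G.fst g = a)
    (hi : crossBlocks a b c d i = ((a, q), (q', q''))) :
    G.typeA g a b c d i = (fun ω => Function.update ω g false) ⁻¹'
      (G.vMark (G.snd g) a q q' q'' ∩ G.markFree a (G.snd g) q q' q'' ∩ G.sepEvent q' q'') := by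
  ext ω
  rw [typeA, Set.mem_setOf_eq, G.sepAllFour_iff_canon g a b c d q q' q'' i hi ω]
  simp only [hi, Set.mem_preimage, Set.mem_inter_iff, vMark, markFree,
    pairEvent, sepEvent, connEvent, linksPair, ConnWithout, Set.mem_compl_iff, hg, Set.mem_setOf_eq]
  set ω' := Function.update ω g false
  set v := G.snd g
  have tr : ∀ {x y z : V}, G.Conn ω' x y → G.Conn ω' y z → G.Conn ω' x z := fun h1 h2 => h1.trans h2
  have sy : ∀ {x y : V}, G.Conn ω' x y → G.Conn ω' y x := fun h => h.symm
  constructor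
  · rintro ⟨⟨haq, haq', haq'', hqq', hqq'', hq'q''⟩, hl⟩
    have hvq : G.Conn ω' v q := by
      rcases hl with (⟨_, h⟩ | ⟨h, _⟩) | (⟨h, _⟩ | ⟨h, _⟩)
      · exact h
      · exact absurd h haq
      · exact absurd h haq'
      · exact absurd h haq''
    have h1 : ¬ G.Conn ω' v q' := fun h => hqq' (tr (sy hvq) h)
    have h2 : ¬ G.Conn ω' v q'' := fun h => hqq'' (tr (sy hvq) h)
    have h3 : ¬ G.Conn ω' v a := fun h => haq (tr (sy h) hvq)
    have h4 : ¬ G.Conn ω' a v := fun h => haq (tr h hvq)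
    exact ⟨⟨⟨⟨⟨hvq, h1⟩, h2⟩, h3⟩, ⟨⟨⟨h4, haq⟩, haq'⟩, haq''⟩⟩, hq'q''⟩
  · rintro ⟨⟨⟨⟨⟨hvq, hvq'⟩, hvq''⟩, _⟩, ⟨⟨⟨_, haq⟩, haq'⟩, haq''⟩⟩, hq'q''⟩
    exact ⟨⟨haq, haq', haq'', fun h => hvq' (tr hvq h), fun h => hvq'' (tr hvq h), hq'q''⟩,
      Or.inl (Or.inl ⟨Conn.refl G ω' a, hvq⟩)⟩

section Prob

variable [Fintype E]

/-- **C-014, typed** (`vMark_block_flip` on the merge types): for every edge `g` with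
`G.fst g = a` and every crossing cell `i` (blocks `{a, q}`, `{q′, q″}`),
`P_p(B_q) · P_p(q′ ↮ q″ in G − g) ≤ P_p(A_q) · P_p(q′ ↔ q″ in G − g)`. -/
theorem C014_typed {p : E → ℝ} (hp : IsProb p) (g : E) (a b c d : V) (hg : G.fst g = a)
    (i : Fin 3) :
    prob p (G.typeB g a b c d i) *
        prob p {ω | ¬ G.ConnWithout g ω (crossBlocks a b c d i).2.1 (crossBlocks a b c d i).2.2} ≤
      prob p (G.typeA g a b c d i) *
        prob p {ω | G.ConnWithout g ω (crossBlocks a b c d i).2.1 (crossBlocks a b c d i).2.2} := by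
  obtain ⟨q, q', q'', hi⟩ : ∃ q q' q'' : V, crossBlocks a b c d i = ((a, q), (q', q'')) := by
    fin_cases i <;> exact ⟨_, _, _, rfl⟩
  have hJ : {ω | G.ConnWithout g ω (crossBlocks a b c d i).2.1 (crossBlocks a b c d i).2.2} =
      (fun ω => Function.update ω g false) ⁻¹' G.connEvent q' q'' := by
    ext ω; simp [hi, ConnWithout, connEvent]
  have hJc : {ω | ¬ G.ConnWithout g ω (crossBlocks a b c d i).2.1 (crossBlocks a b c d i).2.2} =
      (fun ω => Function.update ω g false) ⁻¹' G.sepEvent q' q'' := by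
    ext ω; simp [hi, ConnWithout, sepEvent, connEvent]
  rw [hJ, hJc, G.typeB_eq_preimage g a b c d q q' q'' i hg hi,
    G.typeA_eq_preimage g a b c d q q' q'' i hg hi, prob_preimage_update_false,
    prob_preimage_update_false, prob_preimage_update_false, prob_preimage_update_false]
  exact G.vMark_block_flip a (G.snd g) q q' q'' (hp.update g (x := 0) ⟨le_refl 0, zero_le_one⟩)


/-! ### The `Y`-types of `Lemma6Gen` and the corollary `Lemma6GenJ` -/

end Prob

/-- `C^v_r` in the event vocabulary: the cluster of `v` contains the two marks `s`, `t` other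
than `a`, `r`; `r` and `a` are alone (`K_v ∩ M = {s, t}`, `K_a ∩ M = ∅`). -/
def yC (v a r s t : V) : Set (Config E) :=
  G.connEvent v s ∩ G.connEvent v t ∩ G.sepEvent v r ∩ G.markFree a v r s t

/-- `B_r` in the event vocabulary: `K_v ∩ M = {r}`, `s ↔ t`, `K_a ∩ M = ∅` (`= F_r ∩ N ∩ J_r`). -/
def yB (v a r s t : V) : Set (Config E) :=
  G.vMark v a r s t ∩ G.markFree a v r s t ∩ G.connEvent s t

omit [DecidableEq E] in
/-- `yC` does not depend on the order of `s`, `t`. -/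
theorem yC_comm (v a r s t : V) : G.yC v a r t s = G.yC v a r s t := by
  ext ω
  simp only [yC, markFree, Set.mem_inter_iff]
  tauto

omit [DecidableEq E] in
/-- `yB` does not depend on the order of `s`, `t`. -/
theorem yB_comm (v a r s t : V) : G.yB v a r t s = G.yB v a r s t := by
  ext ω
  simp only [yB, vMark, pairEvent, markFree, Set.mem_inter_iff, G.connEvent_comm t s]
  tauto

/-- `C^v_j` as a pull-back (`j` pairs `a` with `r`, other block `{s, t}`). -/
theorem typeCv_eq_preimage (g : E) (a b c d r s t : V) (j : Fin 3) (hg : G.fst g = a)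
    (hj : crossBlocks a b c d j = ((a, r), (s, t))) :
    G.typeCv g a b c d j = (fun ω => Function.update ω g false) ⁻¹' G.yC (G.snd g) a r s t := by
  ext ω
  simp only [typeCv, hj, Set.mem_setOf_eq, Set.mem_preimage, Set.mem_inter_iff, yC, markFree,
    sepEvent, connEvent, isRank1Cell, ConnWithout, Set.mem_compl_iff, hg]
  set ω' := Function.update ω g false
  set v := G.snd g
  have tr : ∀ {x y z : V}, G.Conn ω' x y → G.Conn ω' y z → G.Conn ω' x z := fun h1 h2 => h1.trans h2
  have sy : ∀ {x y : V}, G.Conn ω' x y → G.Conn ω' y x := fun h => h.symm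
  constructor
  · rintro (⟨⟨_, has, hat, _, _, _⟩, _, hl⟩ | ⟨⟨hst, hsa, hsr, hta, htr, har⟩, hvs, _⟩)
    · rcases hl with h | h
      · exact absurd h has
      · exact absurd h hat
    · exact ⟨⟨⟨hvs, tr hvs hst⟩, fun h => hsr (tr (sy hvs) h)⟩,
        ⟨⟨fun h => hsa (sy (tr h hvs)), har⟩, fun h => hsa (sy h)⟩, fun h => hta (sy h)⟩
  · rintro ⟨⟨⟨hvs, hvt⟩, hvr⟩, ⟨⟨hav, har⟩, has⟩, hat⟩
    right
    exact ⟨⟨tr (sy hvs) hvt, fun h => has (sy h), fun h => hvr (tr hvs h), fun h => hat (sy h),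
      fun h => hvr (tr hvt h), har⟩, hvs, Or.inl (Conn.refl G ω' a)⟩

section Prob

variable [Fintype E]

/-- The four `Y`-types of the crossing cell `(q; q′, q″)` are pairwise disjoint subsets of
`Jᶜ = {q′ ↮ q″}`: their probabilities sum to at most `P(Jᶜ)`. -/
theorem ysum_le_sep (v a q q' q'' : V) {p : E → ℝ} (hp : IsProb p) :
    prob p (G.yC v a q' q q'') + prob p (G.yB v a q' q q'') +
        prob p (G.yC v a q'' q q') + prob p (G.yB v a q'' q q') ≤
      prob p (G.sepEvent q' q'') := by
  have dis : ∀ A B : Set (Config E), (∀ ω, ω ∈ A → ω ∈ B → False) → Disjoint A B :=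
    fun A B h => Set.disjoint_left.2 fun ω hA hB => h ω hA hB
  have d1 : Disjoint (G.yC v a q' q q'') (G.yB v a q' q q'') := by
    refine dis _ _ fun ω h1 h2 => ?_
    simp only [yC, yB, vMark, pairEvent, markFree, sepEvent, connEvent, Set.mem_inter_iff,
      Set.mem_compl_iff, Set.mem_setOf_eq] at h1 h2
    tauto
  have d2 : Disjoint (G.yC v a q' q q'' ∪ G.yB v a q' q q'') (G.yC v a q'' q q') := by
    rw [Set.disjoint_union_left]
    constructor <;> refine dis _ _ fun ω h1 h2 => ?_ <;>
      simp only [yC, yB, vMark, pairEvent, markFree, sepEvent, connEvent, Set.mem_inter_iff,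
        Set.mem_compl_iff, Set.mem_setOf_eq] at h1 h2 <;> tauto
  have d3 : Disjoint (G.yC v a q' q q'' ∪ G.yB v a q' q q'' ∪ G.yC v a q'' q q')
      (G.yB v a q'' q q') := by
    rw [Set.disjoint_union_left, Set.disjoint_union_left]
    refine ⟨⟨?_, ?_⟩, ?_⟩ <;> refine dis _ _ fun ω h1 h2 => ?_ <;>
      simp only [yC, yB, vMark, pairEvent, markFree, sepEvent, connEvent, Set.mem_inter_iff,
        Set.mem_compl_iff, Set.mem_setOf_eq] at h1 h2 <;> tauto
  have hsub : G.yC v a q' q q'' ∪ G.yB v a q' q q'' ∪ G.yC v a q'' q q' ∪ G.yB v a q'' q q' ⊆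
      G.sepEvent q' q'' := by
    intro ω hω
    simp only [yC, yB, vMark, pairEvent, markFree, sepEvent, connEvent, Set.mem_union,
      Set.mem_inter_iff, Set.mem_compl_iff, Set.mem_setOf_eq] at hω ⊢
    have t1 : G.Conn ω v q'' → G.Conn ω q' q'' → G.Conn ω v q' := fun h1 h2 => h1.trans h2.symm
    have t2 : G.Conn ω v q' → G.Conn ω q' q'' → G.Conn ω v q'' := fun h1 h2 => h1.trans h2
    tauto
  rw [← prob_union_of_disjoint p d1, ← prob_union_of_disjoint p d2, ← prob_union_of_disjoint p d3]
  exact prob_mono hp hsub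

/-- The `Lemma6GenJ` inequality for one crossing cell `i`, given the two other cells `j₁`, `j₂`
with their `Y`-types identified as pull-backs. -/
theorem Lemma6GenJ_of (g : E) (a b c d q q' q'' : V) (i j₁ j₂ : Fin 3) (hg : G.fst g = a)
    (hi : crossBlocks a b c d i = ((a, q), (q', q'')))
    (hsum : ∀ p : E → ℝ, (∑ j : Fin 3, if i ≠ j then
        prob p (G.typeCv g a b c d j) + prob p (G.typeB g a b c d j) else 0) =
      prob p (G.typeCv g a b c d j₁) + prob p (G.typeB g a b c d j₁) +
        prob p (G.typeCv g a b c d j₂) + prob p (G.typeB g a b c d j₂))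
    (h1 : G.typeCv g a b c d j₁ =
      (fun ω => Function.update ω g false) ⁻¹' G.yC (G.snd g) a q' q q'')
    (h2 : G.typeB g a b c d j₁ =
      (fun ω => Function.update ω g false) ⁻¹' G.yB (G.snd g) a q' q q'')
    (h3 : G.typeCv g a b c d j₂ =
      (fun ω => Function.update ω g false) ⁻¹' G.yC (G.snd g) a q'' q q')
    (h4 : G.typeB g a b c d j₂ =
      (fun ω => Function.update ω g false) ⁻¹' G.yB (G.snd g) a q'' q q')
    {p : E → ℝ} (hp : IsProb p) :
    prob p (G.typeB g a b c d i) *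
        (∑ j : Fin 3, if i ≠ j then
          prob p (G.typeCv g a b c d j) + prob p (G.typeB g a b c d j) else 0) ≤
      prob p (G.typeA g a b c d i) *
        prob p {ω | G.ConnWithout g ω (crossBlocks a b c d i).2.1 (crossBlocks a b c d i).2.2} := by
  have hC := G.C014_typed hp g a b c d hg i
  have hB0 := prob_nonneg hp (G.typeB g a b c d i)
  have hJc : {ω | ¬ G.ConnWithout g ω (crossBlocks a b c d i).2.1 (crossBlocks a b c d i).2.2} =
      (fun ω => Function.update ω g false) ⁻¹' G.sepEvent q' q'' := by
    ext ω; simp [hi, ConnWithout, sepEvent, connEvent]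
  rw [hJc, prob_preimage_update_false] at hC
  rw [hsum p, h1, h2, h3, h4, prob_preimage_update_false, prob_preimage_update_false,
    prob_preimage_update_false, prob_preimage_update_false]
  have hp0 : IsProb (Function.update p g 0) := hp.update g (x := 0) ⟨le_refl 0, zero_le_one⟩
  exact le_trans (mul_le_mul_of_nonneg_left (G.ysum_le_sep (G.snd g) a q q' q'' hp0) hB0) hC

/-- **`Lemma6GenJ`** — `Lemma6Gen` (typer-2's `Lemma6.lean`, FALSE) with the right-hand factor
`P(E^v)` weakened to `P(J) = P(q′ ↔ q″ in G − g)`: a theorem, for every multigraph, `p`, edge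
`g` with `G.fst g = a`, and crossing cell `i`. -/
theorem Lemma6GenJ {p : E → ℝ} (hp : IsProb p) (g : E) (a b c d : V) (hg : G.fst g = a)
    (i : Fin 3) :
    prob p (G.typeB g a b c d i) *
        (∑ j : Fin 3, if i ≠ j then
          prob p (G.typeCv g a b c d j) + prob p (G.typeB g a b c d j) else 0) ≤
      prob p (G.typeA g a b c d i) *
        prob p {ω | G.ConnWithout g ω (crossBlocks a b c d i).2.1 (crossBlocks a b c d i).2.2} :=
  match i with
  | 0 => G.Lemma6GenJ_of g a b c d b c d 0 1 2 hg rfl (fun p => by simp [Fin.sum_univ_three, add_assoc])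
      (G.typeCv_eq_preimage g a b c d c b d 1 hg rfl) (G.typeB_eq_preimage g a b c d c b d 1 hg rfl)
      (G.typeCv_eq_preimage g a b c d d b c 2 hg rfl) (G.typeB_eq_preimage g a b c d d b c 2 hg rfl) hp
  | 1 => G.Lemma6GenJ_of g a b c d c b d 1 0 2 hg rfl (fun p => by simp [Fin.sum_univ_three, add_assoc])
      (G.typeCv_eq_preimage g a b c d b c d 0 hg rfl) (G.typeB_eq_preimage g a b c d b c d 0 hg rfl)
      (by rw [G.typeCv_eq_preimage g a b c d d b c 2 hg rfl, G.yC_comm (G.snd g) a d c b])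
      (by rw [G.typeB_eq_preimage g a b c d d b c 2 hg rfl, ← G.yB_comm (G.snd g) a d c b]; rfl) hp
  | 2 => G.Lemma6GenJ_of g a b c d d b c 2 0 1 hg rfl (fun p => by simp [Fin.sum_univ_three, add_assoc])
      (by rw [G.typeCv_eq_preimage g a b c d b c d 0 hg rfl, G.yC_comm (G.snd g) a b d c])
      (by rw [G.typeB_eq_preimage g a b c d b c d 0 hg rfl, ← G.yB_comm (G.snd g) a b d c]; rfl)
      (by rw [G.typeCv_eq_preimage g a b c d c b d 1 hg rfl, G.yC_comm (G.snd g) a c d b])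
      (by rw [G.typeB_eq_preimage g a b c d c b d 1 hg rfl, ← G.yB_comm (G.snd g) a c d b]; rfl) hp

end Prob

end MultiGraph

end PercRepro
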